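import Literature.NumberTheory.GaloisRepresentations.HomPermutationModuleVanishing
import Literature.NumberTheory.GaloisRepresentations.GaloisCohomologyUnitsLayerInflation
import Literature.NumberTheory.GaloisRepresentations.InfResTwoExact
import Literature.NumberTheory.GaloisRepresentations.PresentationGaloisModules
import HarnessLib

/-!
# Restriction to `Γ_L` is injective on `H²(K, Hom(ℤ[β], K̄ˣ))` for a permutation module with uniform isotropy `Γ_L`
# (inflation–restriction in degree two + Hilbert 90 + Shapiro at the trivial layer)

Topic `NumberTheory/GaloisRepresentations`; namespace `Literature.NumberTheory.GaloisRepresentations.HomPermutation`.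
Theorems only; no definition, no named fact, no instance, no `sorry`.  Sequel of `HomPermutationModuleVanishing` (door-c6:
`UniformIsotropy`, `PermutedBasis`, `isZero_layer_hom` — Brown III (5.8) + Shapiro at the finite layers),
`GaloisCohomologyUnitsLayerInflation` (`subsingleton_one_units_absGaloisFixingSubgroup`: Hilbert 90 for `Γ_L ≤ Γ_K` on
`K̄ˣ`; `absGaloisLayerH2Equiv`) and `InfResTwoExact` (`exact_inf_res_two`: `0 → H²(G/N, A^N) → H²(G, A) → H²(N, A)`).

THE MATHEMATICS.  `K` a field of characteristic `0`, `L ⊆ K̄` finite Galois over `K`, `Γ_L = Gal(K̄/L) ⊴ Γ_K` (open), `P` a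
discrete `Γ_K`-module with a `ℤ`-basis `(e_b)_{b ∈ β}` permuted by `Γ_K` with every isotropy group equal to `Γ_L` (door-c4's
`P = ℤ[Γ_K/Γ_L]^m`), `A` a discrete `Γ_K`-module.
* §1 `subsingleton_one_hom_restrict` — **`H¹(Γ_L, Hom_ℤ(P, A)) = 0` as soon as `H¹(Γ_L, A) = 0`**: `Γ_L` fixes the
  basis, so a crossed homomorphism `φ : Γ_L → Hom(P, A)` is a family of crossed homomorphisms `u ↦ φ(u)(e_b)` into `A`, each
  principal, `= u c_b − c_b`; then `φ = ∂ F₀` for the homomorphism `F₀ : e_b ↦ c_b`.  With `A = K̄ˣ`: Hilbert 90 on `Γ_L`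
  (`subsingleton_one_hom_units_restrict`).
* §2 `subsingleton_two_hom_quotientInvariants` — **`H²(Γ_K/Γ_L, Hom_ℤ(P, A)^{Γ_L}) = 0`** (continuous cohomology of the finite
  quotient): door-c6's `isZero_layer_hom` at the layer `E = L` itself, where the isotropy `Γ_L/Γ_L` is the trivial group
  and `H²(1, ·) = 0` (Mathlib `isZero_groupCohomology_succ_of_subsingleton`), transported along `absGaloisLayerH2Equiv`.
* §3 **`eq_zero_of_resH_two_hom_units_eq_zero`** — a class of `H²(K, Hom_ℤ(P, K̄ˣ))` whose restriction to `Γ_L` vanishes is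
  zero (`exact_inf_res_two` + §1 + §2); specialised to door-c4's presentation of a finite Galois module `M`
  (`P = ℤ[Γ_K/U_{K(M)}]^{|M|}`, `L = K(M)`): **`eq_zero_of_resH_two_presModule₂_eq_zero`**.

USE (cell `bsd-wall`, seat `bsd-line-chl-p2`, PT2 road of K4 `RedSplitControlAtThree`): this is step (A1) of input (A) of
`HomDual.exists_shaTwoConnecting_eq_of_localGlobal` — the local–global principle for `H²(K, Hom(P, K̄ˣ)) ≅ Br(K(M))^{|M|}`
on `Ш²`-classes reduces to the vanishing of the RESTRICTED class on `Γ_{K(M)}`, where `Hom(P, K̄ˣ)` is a product of copies of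
`K̄ˣ` and Brauer–Hasse–Noether for `K(M)` applies (steps (A2), (A3), not here).
HONEST FRAMING: Galois-cohomological bookkeeping; no arithmetic statement, no case of Poitou–Tate or BSD is proved here.

## References
* J.-P. Serre, *Galois Cohomology* (1997), I §2.5 Prop. 10 (Shapiro), I §2.6 (b) (inflation–restriction).
  [SerreGaloisCohomology1997]
* J.-P. Serre, *Local Fields* (1979), X §1 Prop. 2 (Hilbert 90). [SerreLocalFields1979]
* K. S. Brown, *Cohomology of Groups* (1982), III §5 Prop. (5.8), III §6 Prop. (6.2). [Brown1982CohomologyGroups]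
* J. S. Milne, *Arithmetic Duality Theorems* (2nd ed. 2006), I Lemma 4.13 (proof), Thm. 4.10 (a). [MilneADT2006]
-/

noncomputable section

namespace Literature.NumberTheory.GaloisRepresentations

namespace HomPermutation

open CategoryTheory CategoryTheory.Limits groupCohomology Field
open Literature.Algebra.Homology Literature.Algebra.Homology.DiscreteRep DiscreteGaloisModule

/-! ## §1 `H¹(Γ_L, Hom(P, A)) = 0` from `H¹(Γ_L, A) = 0` -/

section HOne

variable {K : Type} [Field K]
variable {β : Type} [MulAction (absoluteGaloisGroup K) β]
  {L : IntermediateField K (AlgebraicClosure K)} [Normal K L]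
  {VP : Type} [AddCommGroup VP] [TopologicalSpace VP] [DiscreteTopology VP] [Module.Finite ℤ VP]
  {ρP : DiscreteGaloisModule K VP} {e : Module.Basis β ℤ VP}
  {W : Type} [AddCommGroup W] [TopologicalSpace W] [DiscreteTopology W]

/-- On `Γ_L` the action on `Hom(P, A)` is post-composition on basis vectors: `(u · F)(e_b) = u (F(e_b))` (`Γ_L` fixes
`e_b`). [cite: Brown1982CohomologyGroups, III §5 Prop. (5.8)] -/
theorem restrict_hom_apply_basis (hstab : UniformIsotropy K β L) (he : PermutedBasis K ρP e) (ρA : DiscreteGaloisModule K W)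
    (u : absGaloisFixingSubgroup L) (F : DiscreteRep.HomCarrier VP W) (b : β) :
    (show VP →ₗ[ℤ] W from ((homGaloisModule ρP ρA).restrict (subgroupIncl (absGaloisFixingSubgroup L))) u F) (e b) =
      ρA (u : absoluteGaloisGroup K) ((show VP →ₗ[ℤ] W from F) (e b)) := by
  rw [ContinuousRep.restrict_apply]
  change (show VP →ₗ[ℤ] W from homGaloisModule ρP ρA (u : absoluteGaloisGroup K) F) (e b) = _
  rw [homGaloisModule_apply, LinearMap.comp_apply, LinearMap.comp_apply, ← Subgroup.coe_inv,
    apply_eq_self hstab he le_rfl (u⁻¹).2 (e b)]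

/-- **`H¹(Γ_L, Hom_ℤ(P, A)) = 0` as soon as `H¹(Γ_L, A) = 0`**, for a permutation module `P = ℤ[β]` whose basis has uniform
isotropy `Γ_L` (so `Γ_L` fixes the basis): a crossed homomorphism `φ : Γ_L → Hom(P, A)` gives crossed homomorphisms
`u ↦ φ(u)(e_b)` into `A`, each principal `= u c_b − c_b`, and `φ = ∂ F₀` with `F₀(e_b) = c_b`.
[cite: Brown1982CohomologyGroups, III §5 Prop. (5.8)][cite: SerreGaloisCohomology1997, I §2.5] -/
theorem subsingleton_one_hom_restrict (hstab : UniformIsotropy K β L) (he : PermutedBasis K ρP e)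
    (ρA : DiscreteGaloisModule K W)
    (hA : Subsingleton (continuousCohomology 1
      ((ρA.restrict (subgroupIncl (absGaloisFixingSubgroup L))).toTopRep))) :
    Subsingleton (continuousCohomology 1
      (((homGaloisModule ρP ρA).restrict (subgroupIncl (absGaloisFixingSubgroup L))).toTopRep)) := by
  refine ⟨fun x y => ?_⟩
  suffices h : ∀ z : continuousCohomology 1
      (((homGaloisModule ρP ρA).restrict (subgroupIncl (absGaloisFixingSubgroup L))).toTopRep), z = 0 by
    rw [h x, h y]
  intro z
  obtain ⟨φ, rfl⟩ := oneCocycleClass_surjective _ z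
  -- the component crossed homomorphisms `u ↦ φ(u)(e_b)` into `A`
  let φb : β → contOneCocycles ((ρA.restrict (subgroupIncl (absGaloisFixingSubgroup L))).toTopRep) := fun b =>
    ⟨⟨fun u => (show VP →ₗ[ℤ] W from (φ.1 u : DiscreteRep.HomCarrier VP W)) (e b),
      (continuous_of_discreteTopology (f := fun F : DiscreteRep.HomCarrier VP W => (show VP →ₗ[ℤ] W from F) (e b))).comp
        φ.1.continuous⟩, fun u v => by
      change (show VP →ₗ[ℤ] W from (φ.1 (u * v) : DiscreteRep.HomCarrier VP W)) (e b) =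
        (show VP →ₗ[ℤ] W from (φ.1 u : DiscreteRep.HomCarrier VP W)) (e b) +
          (ρA.restrict (subgroupIncl (absGaloisFixingSubgroup L))) u
            ((show VP →ₗ[ℤ] W from (φ.1 v : DiscreteRep.HomCarrier VP W)) (e b))
      rw [φ.2 u v, ContinuousRep.restrict_apply]
      change (show VP →ₗ[ℤ] W from (φ.1 u : DiscreteRep.HomCarrier VP W)) (e b) +
        (show VP →ₗ[ℤ] W from ((homGaloisModule ρP ρA).restrict (subgroupIncl (absGaloisFixingSubgroup L))) u
          (φ.1 v : DiscreteRep.HomCarrier VP W)) (e b) = _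
      rw [restrict_hom_apply_basis hstab he ρA u _ b]
      rfl⟩
  -- each is principal: `φ(u)(e_b) = u c_b − c_b`
  have hb : ∀ b, ∃ c : W, ∀ u : absGaloisFixingSubgroup L,
      (show VP →ₗ[ℤ] W from (φ.1 u : DiscreteRep.HomCarrier VP W)) (e b) = ρA (u : absoluteGaloisGroup K) c - c := by
    intro b
    obtain ⟨c, hc⟩ := (oneCocycleClass_eq_zero_iff _ (φb b)).1 (Subsingleton.elim _ _)
    exact ⟨c, fun u => hc u⟩
  choose c hc using hb
  -- `φ = ∂ F₀` with `F₀(e_b) = c_b`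
  rw [oneCocycleClass_eq_zero_iff]
  let F₀ : DiscreteRep.HomCarrier VP W := e.constr ℤ c
  refine ⟨F₀, fun u => ?_⟩
  change (φ.1 u : DiscreteRep.HomCarrier VP W) =
    ((homGaloisModule ρP ρA).restrict (subgroupIncl (absGaloisFixingSubgroup L))) u F₀ - F₀
  refine (e.ext fun b => ?_ : (show VP →ₗ[ℤ] W from (φ.1 u : DiscreteRep.HomCarrier VP W)) =
    (show VP →ₗ[ℤ] W from (((homGaloisModule ρP ρA).restrict (subgroupIncl (absGaloisFixingSubgroup L))) u F₀ - F₀)))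
  rw [hc b u]
  change _ = (show VP →ₗ[ℤ] W from ((homGaloisModule ρP ρA).restrict (subgroupIncl (absGaloisFixingSubgroup L))) u F₀) (e b)
    - (e.constr ℤ c) (e b)
  rw [restrict_hom_apply_basis hstab he ρA u F₀ b, e.constr_basis]

variable [CharZero K]

/-- **`H¹(Γ_L, Hom_ℤ(P, K̄ˣ)) = 0`** (Hilbert 90 on `Γ_L = Gal(K̄/L)`, `subsingleton_one_units_absGaloisFixingSubgroup`).
[cite: SerreLocalFields1979, X §1 Prop. 2][cite: Brown1982CohomologyGroups, III §5 Prop. (5.8)] -/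
theorem subsingleton_one_hom_units_restrict (hstab : UniformIsotropy K β L) (he : PermutedBasis K ρP e) :
    Subsingleton (continuousCohomology 1
      (((homGaloisModule ρP (units K)).restrict (subgroupIncl (absGaloisFixingSubgroup L))).toTopRep)) := by
  haveI : IsGalois K L := { }
  exact subsingleton_one_hom_restrict hstab he (units K) (subsingleton_one_units_absGaloisFixingSubgroup K L)

end HOne

/-! ## §2 `H²(Γ_K/Γ_L, Hom(P, A)^{Γ_L}) = 0` -/

section HTwo

variable {K : Type} [Field K]
variable {β : Type} [MulAction (absoluteGaloisGroup K) β]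
  {L : IntermediateField K (AlgebraicClosure K)} [FiniteDimensional K L] [Normal K L]
  {VP : Type} [AddCommGroup VP] [TopologicalSpace VP] [DiscreteTopology VP] [Module.Finite ℤ VP]
  {ρP : DiscreteGaloisModule K VP} {e : Module.Basis β ℤ VP}
  {W : Type} [AddCommGroup W] [TopologicalSpace W] [DiscreteTopology W]

omit [FiniteDimensional K L] in
/-- The image of `Γ_L` in `Γ_K/Γ_L` is the trivial subgroup (as a type, a subsingleton). [folklore] -/
private theorem subsingleton_map_mk_self :
    Subsingleton ((absGaloisFixingSubgroup L).map (QuotientGroup.mk' (absGaloisFixingSubgroup L))) := by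
  refine ⟨fun a b => Subtype.ext ?_⟩
  have ha : (a : absoluteGaloisGroup K ⧸ absGaloisFixingSubgroup L) = 1 := by
    obtain ⟨g, hg, hga⟩ := Subgroup.mem_map.1 a.2
    rw [← hga, QuotientGroup.mk'_apply, QuotientGroup.eq_one_iff]
    exact hg
  have hb : (b : absoluteGaloisGroup K ⧸ absGaloisFixingSubgroup L) = 1 := by
    obtain ⟨g, hg, hgb⟩ := Subgroup.mem_map.1 b.2
    rw [← hgb, QuotientGroup.mk'_apply, QuotientGroup.eq_one_iff]
    exact hg
  rw [ha, hb]

omit [FiniteDimensional K L] in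
/-- **`H²(Γ_K/Γ_L, Hom_ℤ(P, A)^{Γ_L}) = 0`** in the finite-group currency (door-c6 `isZero_layer_hom` at the layer `E = L`:
the isotropy `Γ_L/Γ_L` is trivial and `H²` of the trivial group vanishes). [cite: Brown1982CohomologyGroups, III §5 Prop. (5.8), III §6 Prop. (6.2)] -/
theorem isZero_two_layer_hom_self (hstab : UniformIsotropy K β L) (he : PermutedBasis K ρP e)
    (ρA : DiscreteGaloisModule K W) :
    IsZero (groupCohomology (absGaloisLayerRep K L (homGaloisModule ρP ρA)) 2) := by
  haveI := subsingleton_map_mk_self (L := L)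
  exact isZero_layer_hom ρA hstab he le_rfl 2 (isZero_groupCohomology_succ_of_subsingleton _ 1)

/-- **`H²(Γ_K/Γ_L, Hom_ℤ(P, A)^{Γ_L}) = 0`** in continuous cohomology of the (finite, discrete) quotient
(`absGaloisLayerH2Equiv`). [cite: Brown1982CohomologyGroups, III §5 Prop. (5.8)][cite: SerreGaloisCohomology1997, I §2.6] -/
theorem subsingleton_two_hom_quotientInvariants (hstab : UniformIsotropy K β L) (he : PermutedBasis K ρP e)
    (ρA : DiscreteGaloisModule K W) :
    Subsingleton (continuousCohomology 2
      ((homGaloisModule ρP ρA).quotientInvariants (absGaloisFixingSubgroup L)).toTopRep) := by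
  haveI := ModuleCat.subsingleton_of_isZero (isZero_two_layer_hom_self hstab he ρA)
  exact (absGaloisLayerH2Equiv K L (homGaloisModule ρP ρA)).symm.toEquiv.subsingleton

end HTwo

/-! ## §3 Restriction to `Γ_L` is injective on `H²(K, Hom(P, K̄ˣ))` -/

section Injective

variable {K : Type} [Field K] [CharZero K]
variable {β : Type} [MulAction (absoluteGaloisGroup K) β]
  {L : IntermediateField K (AlgebraicClosure K)} [FiniteDimensional K L] [Normal K L]
  {VP : Type} [AddCommGroup VP] [TopologicalSpace VP] [DiscreteTopology VP] [Module.Finite ℤ VP]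
  {ρP : DiscreteGaloisModule K VP} {e : Module.Basis β ℤ VP}

/-- **A class of `H²(K, Hom_ℤ(P, K̄ˣ))` whose restriction to `Γ_L` vanishes is zero** (inflation–restriction in degree two,
`exact_inf_res_two`, with `H¹(Γ_L, Hom(P, K̄ˣ)) = 0` (§1) and `H²(Γ_K/Γ_L, Hom(P, K̄ˣ)^{Γ_L}) = 0` (§2)).
[cite: SerreGaloisCohomology1997, I §2.6 (b)][cite: Brown1982CohomologyGroups, III §6 Prop. (6.2)] -/
theorem eq_zero_of_resH_two_hom_units_eq_zero (hstab : UniformIsotropy K β L) (he : PermutedBasis K ρP e)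
    (x : galoisCohomology (homGaloisModule ρP (units K)) 2)
    (hx : resH (absGaloisFixingSubgroup L) (homGaloisModule ρP (units K)) 2 x = 0) : x = 0 := by
  haveI : IsClosed ((absGaloisFixingSubgroup L : Subgroup (absoluteGaloisGroup K)) : Set (absoluteGaloisGroup K)) :=
    (absGaloisFixingSubgroup L).isClosed_of_isOpen (isOpen_absGaloisFixingSubgroup K L)
  obtain ⟨w, hw⟩ := exists_inf_two_eq_of_resH_eq_zero (absGaloisFixingSubgroup L) (homGaloisModule ρP (units K))
    (subsingleton_one_hom_units_restrict hstab he) x hx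
  haveI : Subsingleton (continuousCohomology 2
      (ContinuousRep.quotientInvariants (absGaloisFixingSubgroup L) (homGaloisModule ρP (units K))).toTopRep) :=
    subsingleton_two_hom_quotientInvariants hstab he (units K)
  rw [← hw, Subsingleton.elim w 0, map_zero]
  rfl

end Injective

/-! ## §4 The case of door-c4's presentation `P = ℤ[Γ_K/U_{K(M)}]^{|M|}` -/

section Presentation

open FreePresentation DGMBridge

variable {K : Type} [Field K] [NumberField K]
variable {M : Type} [AddCommGroup M] [TopologicalSpace M] [DiscreteTopology M] [Finite M]
variable (ρ : DiscreteGaloisModule K M)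

/-- **For door-c4's presentation `0 → N₁ → P → M → 0` of a finite Galois module: a class of `H²(K, Hom_ℤ(P, K̄ˣ))` whose
restriction to `Γ_{K(M)}` vanishes is zero** — step (A1) of input (A) of `HomDual.exists_shaTwoConnecting_eq_of_localGlobal`.
[cite: MilneADT2006, I Lemma 4.13 (proof)][cite: SerreGaloisCohomology1997, I §2.6 (b)] -/
theorem eq_zero_of_resH_two_presModule₂_eq_zero
    (x : haveI := moduleFinite_presModule₂ ρ
      galoisCohomology (homGaloisModule (presModule₂ ρ) (units K)) 2)
    (hx : haveI := moduleFinite_presModule₂ ρ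
      haveI := (presentationLayer ρ).isGalois
      resH (absGaloisFixingSubgroup (presentationLayer ρ).1) (homGaloisModule (presModule₂ ρ) (units K)) 2 x = 0) :
    x = 0 := by
  haveI := moduleFinite_presModule₂ ρ
  haveI := (presentationLayer ρ).finiteDimensional
  haveI := (presentationLayer ρ).isGalois
  exact eq_zero_of_resH_two_hom_units_eq_zero (uniformIsotropy_presIndex ρ) (permutedBasis_presModule₂ ρ) x hx

end Presentation

end HomPermutation

end Literature.NumberTheory.GaloisRepresentations

end
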